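import Summits.Ventures.PercRepro.S1TriangleCountSharperA

/-!
# PercRepro — THE SHARPER TRIANGLE COUNT AT BOUNDED NULLITY, PART B: `2·s₃ + 3ν ≤ ν² + 12` under (C1) (p8, gen 19; a
feeder for S4 — the top of the `q = 7` window, the row `65`)

In the rigid case of Part A (`t_x + 1 = ν` with a triangle `T` avoiding `x`) a point `y ∈ T` lies on at most `4`
triangles — `T`, at most one through `x`, and at most two others, each containing the partner of one of the two other
points of `T` (`ncard_trianglesThrough_le_four_of_tight`) — and deleting `y` instead of `x` pays `4 ≤ ν − 2` for `ν ≥ 6`.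
With `f(ν) = (ν² − 3ν + 12)/2`: `f(ν) − f(ν − 1) = ν − 2`, and `f ≥ C(ν, 2) + 1` for `ν ≤ 5`:
**`two_mul_ncard_triangles_add_le_sq_add_twelve`**: `2·s₃ + 3ν ≤ ν² + 12`. Against the sharp count at `ν = 33`: `501`
against `529` — the cell `(65, 33)` of the level-`7` chain. Axioms: standard.
-/

open scoped Matroid

namespace PercRepro

namespace S1

open Set

variable {α : Type}

/-- **In the rigid case a point of `T` lies on at most `4` triangles**: `T` itself, at most one triangle through `x`, and
the others each contain the partner `b` of one of the two other points `a` of `T` (the third point of the triangle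
`{x, a, b}`) — at most one triangle through `y` per partner. -/
theorem ncard_trianglesThrough_le_four_of_tight (M : Matroid α) [M.Finite]
    (hC1 : ∀ L ⊆ M.E, M.eRk L = 2 → L.ncard ≤ 3) {x : α} (hx : M.IsNonloop x)
    {T : Set α} (hT : T ∈ ThmN.triangles M) (hxT : x ∉ T) {d : ℕ}
    (hd : M.E.encard = M.eRank + d) (htight : (ThmN.trianglesThrough M x).ncard + 1 = d)
    {y : α} (hyT : y ∈ T) : (ThmN.trianglesThrough M y).ncard ≤ 4 := by
  classical
  have hxE : x ∈ M.E := hx.mem_ground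
  have hTE : T ⊆ M.E := hT.1.subset_ground
  have hTfin : T.Finite := M.ground_finite.subset hTE
  have hyx : y ≠ x := fun h => hxT (h ▸ hyT)
  have hTr : M.eRk T = 2 := eRk_eq_two_of_ncard_three_circuit M hT.1 hT.2
  -- `x ∉ cl T`
  have hxcl : x ∉ M.closure T := by
    intro hxcl
    have h1 : M.eRk (insert x T) = 2 := by
      rw [← M.eRk_closure_eq, Matroid.closure_insert_eq_of_mem_closure hxcl, M.eRk_closure_eq, hTr]
    have h2 := hC1 (insert x T) (insert_subset hxE hTE) h1
    rw [ncard_insert_of_notMem hxT hTfin, hT.2] at h2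
    omega
  have hSfin : (ThmN.trianglesThrough M y).Finite :=
    M.ground_finite.finite_subsets.subset (fun C hC => hC.1.subset_ground)
  -- the three classes of triangles through `y`
  set S₀ : Set (Set α) := {C | C ∈ ThmN.trianglesThrough M y ∧ x ∈ C} with hS₀
  set Sγ : Set (Set α) := {C | C ∈ ThmN.trianglesThrough M y ∧ x ∉ C ∧ C ≠ T} with hSγ
  have hsplit : ThmN.trianglesThrough M y ⊆ insert T (S₀ ∪ Sγ) := by
    intro C hC
    by_cases h1 : C = T
    · exact Or.inl h1
    · by_cases h2 : x ∈ C
      · exact Or.inr (Or.inl ⟨hC, h2⟩)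
      · exact Or.inr (Or.inr ⟨hC, h2, h1⟩)
  have hS₀fin : S₀.Finite := hSfin.subset (fun C hC => hC.1)
  have hSγfin : Sγ.Finite := hSfin.subset (fun C hC => hC.1)
  -- at most one triangle through `y` and `x`
  have hS₀card : S₀.ncard ≤ 1 := by
    rw [ncard_le_one_iff_eq hS₀fin]
    by_cases h : S₀ = ∅
    · exact Or.inl h
    · right
      obtain ⟨C, hC⟩ := nonempty_iff_ne_empty.2 h
      refine ⟨C, ?_⟩
      ext C'
      refine ⟨fun hC' => ?_, fun hC' => by rw [mem_singleton_iff.1 hC']; exact hC⟩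
      rw [mem_singleton_iff]
      by_contra hne
      have hint := ThmN.inter_eq_singleton_of_mem_trianglesThrough M hC1 hC'.1 hC.1 hne
      have : x ∈ C' ∩ C := ⟨hC'.2, hC.2⟩
      rw [hint] at this
      exact hyx (mem_singleton_iff.1 this).symm
  -- the partners of the other two points of `T`
  set P : Set α := {b | ∃ a ∈ T, a ≠ y ∧ ∃ C' ∈ ThmN.trianglesThrough M x, a ∈ C' ∧ b ∈ C' ∧ b ≠ x ∧ b ≠ a}
    with hP
  -- `|P| ≤ 2`: `b ↦ a` is injective into `T ∖ {y}`
  have hPcard : P.ncard ≤ 2 := by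
    have hPmem : ∀ b ∈ P, ∃ a ∈ T \ {y}, ∃ C' ∈ ThmN.trianglesThrough M x, a ∈ C' ∧ b ∈ C' ∧ b ≠ x ∧ b ≠ a := by
      rintro b ⟨a, haT, hay, C', hC', haC', hbC', hbx, hba⟩
      exact ⟨a, ⟨haT, fun h => hay (mem_singleton_iff.1 h)⟩, C', hC', haC', hbC', hbx, hba⟩
    haveI : Nonempty α := ⟨x⟩
    choose! ψ hψ using hPmem
    have hinj : InjOn ψ P := by
      intro b₁ hb₁ b₂ hb₂ heq
      obtain ⟨ha₁, C₁, hC₁, haC₁, hb₁C, hb₁x, hb₁a⟩ := hψ b₁ hb₁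
      obtain ⟨ha₂, C₂, hC₂, haC₂, hb₂C, hb₂x, hb₂a⟩ := hψ b₂ hb₂
      rw [heq] at ha₁ haC₁ hb₁a
      -- `C₁ = C₂`: two triangles through `x` sharing `ψ b₂ ≠ x`
      have hax : ψ b₂ ≠ x := fun h => hxT (h ▸ ha₂.1)
      have hCeq : C₁ = C₂ := by
        by_contra hne
        have hint := ThmN.inter_eq_singleton_of_mem_trianglesThrough M hC1 hC₁ hC₂ hne
        have : ψ b₂ ∈ C₁ ∩ C₂ := ⟨haC₁, haC₂⟩
        rw [hint] at this
        exact hax (mem_singleton_iff.1 this)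
      subst hCeq
      -- `C₁ = {x, ψ b₂, b₁}` has three points, `b₂` is one of them
      have hC₁fin : C₁.Finite := M.ground_finite.subset hC₁.1.subset_ground
      have hC₁eq : C₁ = {x, ψ b₂, b₁} := by
        symm
        refine eq_of_subset_of_ncard_le ?_ ?_ hC₁fin
        · intro z hz
          rcases hz with rfl | rfl | rfl
          · exact hC₁.2.2
          · exact haC₁
          · exact hb₁C
        · rw [hC₁.2.1, ncard_insert_of_notMem, ncard_pair hb₁a.symm]
          intro h
          rcases h with h | h
          · exact hax h.symm
          · exact hb₁x (mem_singleton_iff.1 h).symm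
      have hb₂mem := hb₂C
      rw [hC₁eq] at hb₂mem
      rcases hb₂mem with h | h | h
      · exact absurd h hb₂x
      · exact absurd h hb₂a
      · exact (mem_singleton_iff.1 h).symm
    have hmaps : ∀ b ∈ P, ψ b ∈ T \ {y} := fun b hb => (hψ b hb).1
    calc P.ncard ≤ (T \ {y}).ncard := ncard_le_ncard_of_injOn ψ hmaps hinj (hTfin.sdiff)
      _ = 2 := by rw [ncard_sdiff_singleton_of_mem hyT, hT.2]
  -- every triangle of `Sγ` contains a point of `P`
  have hγ : ∀ C ∈ Sγ, ∃ b ∈ C, b ∈ P := by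
    intro C hC
    obtain ⟨C', hC', a, haC', haT, b, hbC', hbC, hab⟩ :=
      exists_partner_of_avoid_of_tight M hC1 hx hT hxT hd htight ⟨hC.1.1, hC.1.2.1⟩ hC.2.1 hC.2.2
    have hbx : b ≠ x := fun h => hC.2.1 (h ▸ hbC)
    have hax : a ≠ x := fun h => hxT (h ▸ haT)
    -- `a ≠ y`: else `{y, b} ⊆ C` and `{x, y, b} = C'` put `x` on the line of `C`
    have hay : a ≠ y := by
      intro hay
      subst hay
      have hC'fin : C'.Finite := M.ground_finite.subset hC'.1.subset_ground
      have hC'eq : C' = {x, a, b} := by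
        symm
        refine eq_of_subset_of_ncard_le ?_ ?_ hC'fin
        · intro z hz
          rcases hz with rfl | rfl | rfl
          · exact hC'.2.2
          · exact haC'
          · exact hbC'
        · rw [hC'.2.1, ncard_insert_of_notMem, ncard_pair hab]
          intro h
          rcases h with h | h
          · exact hax h.symm
          · exact hbx (mem_singleton_iff.1 h).symm
      have hxcl' : x ∈ M.closure (C' \ {x}) := hC'.1.mem_closure_sdiff_singleton_of_mem hC'.2.2
      have hsub : C' \ {x} ⊆ C := by
        intro z hz
        have hzC : z ∈ C' := hz.1
        rw [hC'eq] at hzC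
        rcases hzC with rfl | rfl | rfl
        · exact absurd rfl hz.2
        · exact hC.1.2.2
        · exact hbC
      have hxCcl : x ∈ M.closure C := M.closure_subset_closure hsub hxcl'
      have hCr : M.eRk C = 2 := eRk_eq_two_of_ncard_three_circuit M hC.1.1 hC.1.2.1
      have h1 : M.eRk (insert x C) = 2 := by
        rw [← M.eRk_closure_eq, Matroid.closure_insert_eq_of_mem_closure hxCcl, M.eRk_closure_eq, hCr]
      have h2 := hC1 (insert x C) (insert_subset hxE hC.1.1.subset_ground) h1
      rw [ncard_insert_of_notMem hC.2.1 (M.ground_finite.subset hC.1.1.subset_ground), hC.1.2.1] at h2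
      omega
    exact ⟨b, hbC, a, haT, hay, C', hC', haC', hbC', hbx, hab.symm⟩
  haveI : Nonempty α := ⟨x⟩
  choose! φ hφ using hγ
  -- `φ` is injective on `Sγ`: two triangles through `y` sharing `φ C ≠ y` coincide
  have hφinj : InjOn φ Sγ := by
    intro C₁ hC₁ C₂ hC₂ heq
    by_contra hne
    have hint := ThmN.inter_eq_singleton_of_mem_trianglesThrough M hC1 hC₁.1 hC₂.1 hne
    have hmem : φ C₁ ∈ C₁ ∩ C₂ := ⟨(hφ C₁ hC₁).1, heq ▸ (hφ C₂ hC₂).1⟩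
    rw [hint] at hmem
    -- `φ C₁ = y`; but `φ C₁ ∈ P` is the partner of a point `a ≠ y` of `T`: `{x, a, y}` a triangle puts `x` on `T`'s line
    obtain ⟨a, haT, hay, C', hC', haC', hbC', hbx, hba⟩ := (hφ C₁ hC₁).2
    rw [mem_singleton_iff.1 hmem] at hbC' hbx hba
    have hxcl' : x ∈ M.closure (C' \ {x}) := hC'.1.mem_closure_sdiff_singleton_of_mem hC'.2.2
    have hC'fin : C'.Finite := M.ground_finite.subset hC'.1.subset_ground
    have hC'eq : C' = {x, a, y} := by
      symm
      refine eq_of_subset_of_ncard_le ?_ ?_ hC'fin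
      · intro z hz
        rcases hz with rfl | rfl | rfl
        · exact hC'.2.2
        · exact haC'
        · exact hbC'
      · rw [hC'.2.1, ncard_insert_of_notMem, ncard_pair hay]
        intro h
        rcases h with h | h
        · exact hxT (h ▸ haT)
        · exact hyx (mem_singleton_iff.1 h).symm
    have hsub : C' \ {x} ⊆ T := by
      intro z hz
      have hzC : z ∈ C' := hz.1
      rw [hC'eq] at hzC
      rcases hzC with rfl | rfl | rfl
      · exact absurd rfl hz.2
      · exact haT
      · exact hyT
    exact hxcl (M.closure_subset_closure hsub hxcl')
  have hPE : P ⊆ M.E := by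
    rintro b ⟨a, haT, hay, C', hC', haC', hbC', hbx, hba⟩
    exact hC'.1.subset_ground hbC'
  have hSγcard : Sγ.ncard ≤ 2 :=
    (ncard_le_ncard_of_injOn φ (fun C hC => (hφ C hC).2) hφinj (M.ground_finite.subset hPE)).trans hPcard
  calc (ThmN.trianglesThrough M y).ncard ≤ (insert T (S₀ ∪ Sγ)).ncard :=
        ncard_le_ncard hsplit ((hS₀fin.union hSγfin).insert T)
    _ ≤ (S₀ ∪ Sγ).ncard + 1 := ncard_insert_le _ _
    _ ≤ S₀.ncard + Sγ.ncard + 1 := by have := ncard_union_le S₀ Sγ; omega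
    _ ≤ 4 := by omega

/-- **THE SHARPER TRIANGLE COUNT at bounded nullity.** If `|E| = r(E) + d` and every rank-`2` set has at most `3`
elements, then `2·s₃ + 3d ≤ d² + 12`, i.e. `s₃ ≤ (d² − 3d + 12)/2`. For `d ≤ 5` this is the sharp count
`2·s₃ ≤ d(d − 1) + 2`; for `d ≥ 6`, deletion induction on `|E|` at a point `x` of a triangle: either every triangle passes
through `x` (`2·s₃ ≤ 2d`), or some triangle `T` avoids `x` and `t_x + 2 ≤ d` (delete `x`), or `t_x + 1 = d` — the rigid
case — and a point `y ∈ T` has `t_y ≤ 4 ≤ d − 2` (delete `y`). -/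
theorem two_mul_ncard_triangles_add_le_sq_add_twelve (M : Matroid α) [M.Finite]
    (hC1 : ∀ L ⊆ M.E, M.eRk L = 2 → L.ncard ≤ 3) {d : ℕ} (hd : M.E.encard = M.eRank + d) :
    2 * (ThmN.triangles M).ncard + 3 * d ≤ d * d + 12 := by
  suffices H : ∀ n : ℕ, ∀ (M : Matroid α) [M.Finite], M.E.ncard = n →
      (∀ L ⊆ M.E, M.eRk L = 2 → L.ncard ≤ 3) → ∀ d : ℕ, M.E.encard = M.eRank + d →
      2 * (ThmN.triangles M).ncard + 3 * d ≤ d * d + 12 from H _ M rfl hC1 d hd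
  intro n
  induction n using Nat.strong_induction_on with
  | _ n ih =>
  intro M _ hn hC1 d hd
  classical
  -- the sharp count settles `d ≤ 5`
  have hV1 := two_mul_ncard_triangles_le_sharp M hC1 hd
  rcases Nat.lt_or_ge d 6 with hd6 | hd6
  · interval_cases d <;> omega
  set S := ThmN.triangles M with hS
  have hSfin : S.Finite :=
    M.ground_finite.finite_subsets.subset (fun C hC => hC.1.subset_ground)
  have hdd : 6 * d ≤ d * d := Nat.mul_le_mul_right d hd6
  by_cases hSe : S = ∅
  · rw [hSe, ncard_empty]; omega
  obtain ⟨C₀, hC₀⟩ := nonempty_iff_ne_empty.2 hSe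
  obtain ⟨x, hxC₀⟩ := hC₀.1.nonempty
  have hxE : x ∈ M.E := hC₀.1.subset_ground hxC₀
  have hx : M.IsNonloop x := by
    refine _root_.Matroid.isNonloop_of_not_isLoop hxE ?_
    intro hloop
    have hC₀x : C₀ = {x} := hloop.eq_of_isCircuit_mem hC₀.1 hxC₀
    have := hC₀.2
    rw [hC₀x, ncard_singleton] at this
    omega
  -- THE DELETION STEP at a point `z` of a triangle: the triangles avoiding `z` are those of `M ＼ {z}`, nullity `d − 1`
  have step : ∀ z : α, (∃ C' ∈ S, z ∈ C') →
      ∃ d' : ℕ, d = d' + 1 ∧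
        2 * {C : Set α | M.IsCircuit C ∧ C.ncard = 3 ∧ z ∉ C}.ncard + 3 * d' ≤ d' * d' + 12 := by
    intro z hz
    obtain ⟨C', hC'S, hzC'⟩ := hz
    have hzE : z ∈ M.E := hC'S.1.subset_ground hzC'
    have hne : ¬ M.IsColoop z := hC'S.1.not_isColoop_of_mem hzC'
    have hν : M✶.eRank = (d : ℕ∞) := by
      have h := _root_.Matroid.eRank_add_eRank_dual M
      rw [hd] at h
      exact WithTop.add_left_cancel (PercRepro.Matroid.eRank_ne_top_of_finite M) h
    have hdel := PercRepro.Matroid.dual_eRank_delete_singleton_add_one hzE hne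
    rw [hν] at hdel
    have hfin' : (M ＼ {z})✶.eRank ≠ ⊤ := by
      intro h
      rw [h] at hdel
      exact absurd hdel (by simp)
    obtain ⟨d', hd'⟩ := ENat.ne_top_iff_exists.1 hfin'
    have hdd' : d = d' + 1 := by
      rw [← hd'] at hdel
      exact_mod_cast hdel.symm
    have hd'enc : (M ＼ {z}).E.encard = (M ＼ {z}).eRank + d' := by
      have h := _root_.Matroid.eRank_add_eRank_dual (M ＼ {z})
      rw [← hd'] at h
      exact h.symm
    have hdelE : (M ＼ {z}).E.ncard < n := by
      rw [_root_.Matroid.delete_ground, ← hn, ← ncard_sdiff_singleton_add_one hzE M.ground_finite]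
      omega
    have hC1' : ∀ L ⊆ (M ＼ {z}).E, (M ＼ {z}).eRk L = 2 → L.ncard ≤ 3 := by
      intro L hL hr
      rw [_root_.Matroid.delete_ground] at hL
      rw [delete_singleton_eRk_eq hL] at hr
      exact hC1 L (hL.trans sdiff_subset) hr
    refine ⟨d', hdd', ?_⟩
    have hsub : {C : Set α | M.IsCircuit C ∧ C.ncard = 3 ∧ z ∉ C} ⊆ ThmN.triangles (M ＼ {z}) := by
      intro C hC
      exact ⟨_root_.Matroid.delete_isCircuit_iff.2 ⟨hC.1, disjoint_singleton_right.2 hC.2.2⟩, hC.2.1⟩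
    have hle := ncard_le_ncard hsub
      ((M ＼ {z}).ground_finite.finite_subsets.subset (fun C hC => hC.1.subset_ground))
    have := ih _ hdelE (M ＼ {z}) rfl hC1' d' hd'enc
    omega
  have hsplitz : ∀ z : α, S.ncard ≤ (ThmN.trianglesThrough M z).ncard +
      {C : Set α | M.IsCircuit C ∧ C.ncard = 3 ∧ z ∉ C}.ncard := by
    intro z
    have hsub : S ⊆ ThmN.trianglesThrough M z ∪ {C : Set α | M.IsCircuit C ∧ C.ncard = 3 ∧ z ∉ C} := by
      intro C hC
      by_cases h : z ∈ C
      · exact Or.inl ⟨hC.1, hC.2, h⟩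
      · exact Or.inr ⟨hC.1, hC.2, h⟩
    have hfin1 : (ThmN.trianglesThrough M z).Finite := hSfin.subset (fun C hC => ⟨hC.1, hC.2.1⟩)
    have hfin2 : {C : Set α | M.IsCircuit C ∧ C.ncard = 3 ∧ z ∉ C}.Finite :=
      hSfin.subset (fun C hC => ⟨hC.1, hC.2.1⟩)
    exact (ncard_le_ncard hsub (hfin1.union hfin2)).trans (ncard_union_le _ _)
  by_cases hB : ∃ T ∈ S, x ∉ T
  · obtain ⟨T, hTS, hxT⟩ := hB
    have h1 : (ThmN.trianglesThrough M x).ncard + 1 ≤ d :=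
      ncard_trianglesThrough_add_one_le M hC1 hx hTS hxT hd
    by_cases htight : (ThmN.trianglesThrough M x).ncard + 1 = d
    · -- the rigid case: delete a point `y` of `T`
      obtain ⟨y, hyT⟩ := hTS.1.nonempty
      have h4 := ncard_trianglesThrough_le_four_of_tight M hC1 hx hTS hxT hd htight hyT
      obtain ⟨d', hdd', h2⟩ := step y ⟨T, hTS, hyT⟩
      have h3 := hsplitz y
      subst hdd'
      nlinarith [h4, h2, h3, hd6]
    · -- `t_x + 2 ≤ d`: delete `x`
      obtain ⟨d', hdd', h2⟩ := step x ⟨C₀, hC₀, hxC₀⟩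
      have h3 := hsplitz x
      have h1' : (ThmN.trianglesThrough M x).ncard + 2 ≤ d := by omega
      subst hdd'
      nlinarith [h1', h2, h3]
  · -- every triangle passes through `x`
    have hall : S ⊆ ThmN.trianglesThrough M x :=
      fun C hC => ⟨hC.1, hC.2, by_contra (fun h => hB ⟨C, hC, h⟩)⟩
    have h1 : (ThmN.trianglesThrough M x).ncard ≤ d := ThmN.ncard_trianglesThrough_le M hC1 hx hd
    have h2 : S.ncard ≤ (ThmN.trianglesThrough M x).ncard :=
      ncard_le_ncard hall (hSfin.subset (fun C hC => ⟨hC.1, hC.2.1⟩))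
    omega

end S1

end PercRepro
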